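import Summits.QuantumAdvantage.QuantumAdvantage.Theorems.LinnikCubicClassGroupsDegreeOnePrimesEscapeFrobeniusWindowPsi
import Summits.QuantumAdvantage.QuantumAdvantage.Theorems.LinnikCubicClassGroupsDegreeOnePrimesEscapeConjClassPNTAll
import Mathlib.Analysis.Convex.SpecificFunctions.Basic
import HarnessLib

/-!
# The Chebotarev density theorem in SHORT INTERVALS in the Linnik range, every conjugacy class

Topic `Summits/QuantumAdvantage/QuantumAdvantage/Theorems`, cell B2b-1 (linnik-cubic), PART A (gen 17); helper
toward the crux `DegreeOnePrimesEscape` (stmt-QuantumAdvantage-11543) of route `LinnikCubicClassGroups`.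
HONEST FRAMING: the value of this file is a THEOREM (kernel-checked, GRH-free, Siegel-free, unconditional) — NOT
summit progress (the route still rests on the hypothesis-type target `PureCubicClassNumberHard`).

**Theorem (`frobeniusClass_shortInterval`; Hoheisel–Linnik–Chebotarev).**  For `n > 1` and `0 < κ ≤ 1` there
are `δ, L, c > 0` such that for every Galois number field `N/ℚ` of degree `n`, every `σ ∈ Gal(N/ℚ)` with class
`C = C(σ)`, every `x ≥ |d_N|^L` and every `h` with `x^{1−δ} ≤ h ≤ x`, writing
`S(y) = Σ_{p ≤ y, p ∤ d_N, Frob_p ∈ C} log p`, `Δ = S(x+h) − S(x)`, `δ_C = |C|/|G|`: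
(A) if `ζ_N` has no real zero in `(1 − c/(log|d_N| + log 4), 1)` then `|Δ − δ_C h| ≤ κ δ_C h`;
(B) if `β₁` is such a zero and `I = ((x+h)^{β₁} − x^{β₁})/β₁ = ∫_x^{x+h} t^{β₁−1} dt`, then
    `|Δ − δ_C (h − I)| ≤ κ δ_C h` if `ζ_{N^{⟨σ⟩}}(β₁) = 0`, and `|Δ − δ_C (h + I)| ≤ κ δ_C h` otherwise.
In particular (`…Corollaries`): `Δ ≤ (2+κ)δ_C h` always; `Δ ≥ (1−κ)δ_C h` unless `β₁` exists with
`ζ_{N^{⟨σ⟩}}(β₁) = 0`; so every such interval `(x, x+h]` contains a prime `p ∤ d_N` with `Frob_p ∈ C` — for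
EVERY class when `N` has no quadratic subfield (e.g. odd degree), and for the classes outside the kernel of
the exceptional character otherwise.  This is the uniform short-interval Chebotarev theorem of Balog–Ono (2001,
per field) / Gun–Naik (2024, Thm. 7: `y ≥ x^{1−c₃/n_L}`, `log x ≫ log(d_L n_L^{n_L})`, error `≤ ¼` of the main
term) with constants depending on the degree only, kernel-checked from the tree's log-free zero-density
estimate for `ζ_N` (Hoheisel's mechanism), Landau–Page, Deuring's reduction and the primitive Hecke
factorisation of `ζ_N/ζ_{N^{⟨σ⟩}}`.
References: G. Hoheisel, S.-B. Preuss. Akad. Wiss. (1930); A. Balog, K. Ono, J. Number Theory 91 (2001) 356–371;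
S. Gun, S. L. Naik, Monatsh. Math. (2024), arXiv:2405.04698, Thm. 7; [LagariasMontgomeryOdlyzko1979, Thm. 1.1];
[ThornerZaman2019].
-/

noncomputable section

open scoped NumberField nonZeroDivisors Classical
open Finset Real Ideal NumberField IsDedekindDomain
open Literature.NumberTheory.NumberFields Literature.NumberTheory.LFunctions
  Literature.NumberTheory.LFunctions.NumberField Literature.NumberTheory.GaloisRepresentations

namespace Summit.QuantumAdvantage.QuantumAdvantage.Theorems.DegreeOnePrimesEscape

/-! ### Real-variable preliminaries -/

/-- Absolute-error transfer from the cyclic sub-extension to the conjugacy class: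
`|T − Main| ≤ E₁`, `|T − νS| ≤ R`, `δν = 1`, `ν > 0` ⟹ `|S − δ Main| ≤ δ(E₁ + R)`. -/
theorem window_transfer {T S Main ν δ E₁ R : ℝ} (hν : 0 < ν) (hδ : δ * ν = 1)
    (h1 : |T - Main| ≤ E₁) (h2 : |T - ν * S| ≤ R) : |S - δ * Main| ≤ δ * (E₁ + R) := by
  have hδpos : 0 < δ := by
    by_contra h; push Not at h
    have : δ * ν ≤ 0 := mul_nonpos_of_nonpos_of_nonneg h hν.le
    linarith
  have hkey : |ν * S - Main| ≤ E₁ + R := by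
    calc |ν * S - Main| = |(ν * S - T) + (T - Main)| := by ring_nf
      _ ≤ |ν * S - T| + |T - Main| := abs_add_le _ _
      _ ≤ R + E₁ := by rw [abs_sub_comm]; exact add_le_add h2 h1
      _ = E₁ + R := by ring
  have e1 : S - δ * Main = δ * (ν * S - Main) := by
    have : δ * ν * S = S := by rw [hδ, one_mul]
    calc S - δ * Main = δ * ν * S - δ * Main := by rw [this]
      _ = δ * (ν * S - Main) := by ring
  rw [e1, abs_mul, abs_of_pos hδpos]
  exact mul_le_mul_of_nonneg_left hkey hδpos.le

/-- **The secondary term is at most `h x^{β−1}`**: `((x+h)^β − x^β)/β ≤ h x^{β−1}` for `0 < β ≤ 1`, `x > 0`,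
`h ≥ 0` (Bernoulli). -/
theorem rpow_window_div_le {x h β : ℝ} (hx : 0 < x) (hh : 0 ≤ h) (hβ0 : 0 < β) (hβ1 : β ≤ 1) :
    ((x + h) ^ β - x ^ β) / β ≤ h * x ^ (β - 1) := by
  have hs : -1 ≤ h / x := le_trans (by norm_num) (div_nonneg hh hx.le)
  have hB := rpow_one_add_le_one_add_mul_self hs hβ0.le hβ1
  have hxh : x + h = x * (1 + h / x) := by field_simp
  have h1 : (x + h) ^ β = x ^ β * (1 + h / x) ^ β := by
    rw [hxh, Real.mul_rpow hx.le (by linarith [div_nonneg hh hx.le])]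
  have hxβ : 0 < x ^ β := Real.rpow_pos_of_pos hx _
  have h2 : (x + h) ^ β - x ^ β ≤ x ^ β * (β * (h / x)) := by
    rw [h1]; nlinarith [mul_le_mul_of_nonneg_left hB hxβ.le]
  have h3 : x ^ β * (β * (h / x)) = β * (h * x ^ (β - 1)) := by
    rw [Real.rpow_sub_one hx.ne']; field_simp
  rw [div_le_iff₀ hβ0]
  linarith

/-- `(x+h)^{3/4} ≤ 2 x^{3/4}` for `0 ≤ h ≤ x`, `0 < x`. -/
theorem rpow_threeQuarters_add_le {x h : ℝ} (hx : 0 < x) (hh : 0 ≤ h) (hhx : h ≤ x) :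
    (x + h) ^ (3 / 4 : ℝ) ≤ 2 * x ^ (3 / 4 : ℝ) := by
  have h1 : (x + h) ^ (3 / 4 : ℝ) ≤ (2 * x) ^ (3 / 4 : ℝ) :=
    Real.rpow_le_rpow (by linarith) (by linarith) (by norm_num)
  have h2 : (2 * x) ^ (3 / 4 : ℝ) = (2 : ℝ) ^ (3 / 4 : ℝ) * x ^ (3 / 4 : ℝ) := Real.mul_rpow (by norm_num) hx.le
  have h3 : (2 : ℝ) ^ (3 / 4 : ℝ) ≤ 2 := by
    have := Real.rpow_le_rpow_of_exponent_le (show (1:ℝ) ≤ 2 by norm_num) (show (3/4 : ℝ) ≤ 1 by norm_num)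
    rwa [Real.rpow_one] at this
  have hx34 : 0 ≤ x ^ (3 / 4 : ℝ) := Real.rpow_nonneg hx.le _
  nlinarith

/-- **The junk threshold**: for `x ≥ d^L`, `d ≥ 3`, `L ≥ (64/15) log(480 n/κ)`, `L ≥ 0`, `δ ≤ 1/64` and
`x^{1−δ} ≤ h`:
`120 n x^{3/4} ≤ (κ/4) h`. -/
theorem junk_le_quarter_mul {n κ d L δ x h : ℝ} (hn : 0 < n) (hκ : 0 < κ) (hd : 3 ≤ d)
    (hL : 64 / 15 * Real.log (480 * n / κ) ≤ L) (hL0 : 0 ≤ L) (hx : d ^ L ≤ x) (hδ : δ ≤ 1 / 64)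
    (hhx : x ^ (1 - δ) ≤ h) :
    120 * n * x ^ (3 / 4 : ℝ) ≤ κ / 4 * h := by
  have hd0 : 0 < d := by linarith
  have hd1 : 1 < d := by linarith
  have hx1 : 1 ≤ x := le_trans (Real.one_le_rpow hd1.le hL0) hx
  have hx0 : 0 < x := by linarith
  -- `log x ≥ L log 3 ≥ L`
  have hlog3 : 1 ≤ Real.log 3 := by
    rw [Real.le_log_iff_exp_le (by norm_num)]
    have := Real.exp_one_lt_d9; linarith
  have hlogx : L ≤ Real.log x := by
    have h1 := Real.log_le_log (Real.rpow_pos_of_pos hd0 L) hx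
    rw [Real.log_rpow hd0] at h1
    have h2 : Real.log 3 ≤ Real.log d := Real.log_le_log (by norm_num) hd
    nlinarith
  -- `x^{15/64} ≥ 480 n/κ`
  have hpow : 480 * n / κ ≤ x ^ (15 / 64 : ℝ) := by
    have h1 : Real.log (480 * n / κ) ≤ 15 / 64 * Real.log x := by nlinarith
    calc 480 * n / κ = Real.exp (Real.log (480 * n / κ)) := (Real.exp_log (by positivity)).symm
      _ ≤ Real.exp (15 / 64 * Real.log x) := Real.exp_le_exp.2 h1
      _ = x ^ (15 / 64 : ℝ) := by rw [Real.rpow_def_of_pos hx0, mul_comm]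
  -- `x^{3/4} · x^{15/64} ≤ x^{1−δ}`
  have hsplit : x ^ (3 / 4 : ℝ) * x ^ (15 / 64 : ℝ) ≤ x ^ (1 - δ) := by
    rw [← Real.rpow_add hx0]
    exact Real.rpow_le_rpow_of_exponent_le hx1 (by linarith)
  have hx34 : 0 ≤ x ^ (3 / 4 : ℝ) := Real.rpow_nonneg hx0.le _
  have h1 : 120 * n * x ^ (3 / 4 : ℝ) * (480 * n / κ) ≤ 120 * n * x ^ (1 - δ) := by
    calc 120 * n * x ^ (3 / 4 : ℝ) * (480 * n / κ) ≤ 120 * n * x ^ (3 / 4 : ℝ) * x ^ (15 / 64 : ℝ) :=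
          mul_le_mul_of_nonneg_left hpow (by positivity)
      _ = 120 * n * (x ^ (3 / 4 : ℝ) * x ^ (15 / 64 : ℝ)) := by ring
      _ ≤ 120 * n * x ^ (1 - δ) := mul_le_mul_of_nonneg_left hsplit (by positivity)
  have h2 : 120 * n * x ^ (1 - δ) ≤ 120 * n * h := mul_le_mul_of_nonneg_left hhx (by positivity)
  have hq : 0 < 480 * n / κ := by positivity
  have h4 : 120 * n * x ^ (3 / 4 : ℝ) ≤ 120 * n * h / (480 * n / κ) := by
    rw [le_div_iff₀ hq]; exact h1.trans h2
  have h5 : 120 * n * h / (480 * n / κ) = κ / 4 * h := by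
    field_simp; ring
  linarith [h4, h5.le, h5.ge]

variable {N : Type} [Field N] [NumberField N] [IsGalois ℚ N]

set_option maxHeartbeats 4000000 in
/-- **The Chebotarev density theorem in short intervals in the Linnik range, every conjugacy class of every
Galois number field** (see the module docstring; `δ_C = |C(σ)|/|G|`, `S(y) = Σ_{p ≤ y, p ∤ d_N, Frob_p ∈ C(σ)} log p`,
`I = ((x+h)^{β₁} − x^{β₁})/β₁`). Unconditional.
[cite: LagariasMontgomeryOdlyzko1979, Theorem 1.1] [cite: ThornerZaman2019, Theorem 1.1] -/
theorem frobeniusClass_shortInterval (n : ℕ) (hn : 1 < n) {κ : ℝ} (hκ : 0 < κ) (hκ1 : κ ≤ 1) :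
    ∃ δ L c : ℝ, 0 < δ ∧ δ ≤ 1 / 64 ∧ 0 < L ∧ 0 < c ∧ c ≤ 1 / 4 ∧ c ≤ 1 / (8 * ((2 * n).factorial : ℝ)) ∧
      ∀ (N : Type) [Field N] [NumberField N] [IsGalois ℚ N], Module.finrank ℚ N = n → ∀ σ : N ≃ₐ[ℚ] N,
      ∀ x h : ℝ, ((NumberField.discr N).natAbs : ℝ) ^ L ≤ x → x ^ (1 - δ) ≤ h → h ≤ x →
        ((¬ ∃ β₁ : ℝ, dedekindZeta₁ N β₁ = 0 ∧
            1 - c / (Real.log ((NumberField.discr N).natAbs : ℝ) + Real.log 4) < β₁ ∧ β₁ < 1) →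
            |(∑ p ∈ (Nat.primesLE ⌊x + h⌋₊).filter
                (fun p : ℕ => ¬ ((p : ℤ) ∣ NumberField.discr N) ∧
                  ∃ (Q : Ideal (𝓞 N)) (_ : Q.IsMaximal) (_ : Q.LiesOver (span {(p : ℤ)})) (φ g : N ≃ₐ[ℚ] N),
                    IsArithFrobAt ℤ φ Q ∧ Q.inertia (N ≃ₐ[ℚ] N) = ⊥ ∧ g * φ * g⁻¹ = σ), Real.log p) -
              (∑ p ∈ (Nat.primesLE ⌊x⌋₊).filter
                (fun p : ℕ => ¬ ((p : ℤ) ∣ NumberField.discr N) ∧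
                  ∃ (Q : Ideal (𝓞 N)) (_ : Q.IsMaximal) (_ : Q.LiesOver (span {(p : ℤ)})) (φ g : N ≃ₐ[ℚ] N),
                    IsArithFrobAt ℤ φ Q ∧ Q.inertia (N ≃ₐ[ℚ] N) = ⊥ ∧ g * φ * g⁻¹ = σ), Real.log p) -
              (Nat.card {τ : N ≃ₐ[ℚ] N // IsConj σ τ} : ℝ) / Nat.card (N ≃ₐ[ℚ] N) * h| ≤
              κ * ((Nat.card {τ : N ≃ₐ[ℚ] N // IsConj σ τ} : ℝ) / Nat.card (N ≃ₐ[ℚ] N) * h)) ∧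
        (∀ β₁ : ℝ, dedekindZeta₁ N β₁ = 0 →
          1 - c / (Real.log ((NumberField.discr N).natAbs : ℝ) + Real.log 4) < β₁ → β₁ < 1 →
          (dedekindZeta₁ (IntermediateField.fixedField (Subgroup.zpowers σ)) β₁ = 0 →
              |(∑ p ∈ (Nat.primesLE ⌊x + h⌋₊).filter
                  (fun p : ℕ => ¬ ((p : ℤ) ∣ NumberField.discr N) ∧
                    ∃ (Q : Ideal (𝓞 N)) (_ : Q.IsMaximal) (_ : Q.LiesOver (span {(p : ℤ)})) (φ g : N ≃ₐ[ℚ] N),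
                      IsArithFrobAt ℤ φ Q ∧ Q.inertia (N ≃ₐ[ℚ] N) = ⊥ ∧ g * φ * g⁻¹ = σ), Real.log p) -
                (∑ p ∈ (Nat.primesLE ⌊x⌋₊).filter
                  (fun p : ℕ => ¬ ((p : ℤ) ∣ NumberField.discr N) ∧
                    ∃ (Q : Ideal (𝓞 N)) (_ : Q.IsMaximal) (_ : Q.LiesOver (span {(p : ℤ)})) (φ g : N ≃ₐ[ℚ] N),
                      IsArithFrobAt ℤ φ Q ∧ Q.inertia (N ≃ₐ[ℚ] N) = ⊥ ∧ g * φ * g⁻¹ = σ), Real.log p) -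
                (Nat.card {τ : N ≃ₐ[ℚ] N // IsConj σ τ} : ℝ) / Nat.card (N ≃ₐ[ℚ] N) *
                  (h - ((x + h) ^ β₁ - x ^ β₁) / β₁)| ≤
                κ * ((Nat.card {τ : N ≃ₐ[ℚ] N // IsConj σ τ} : ℝ) / Nat.card (N ≃ₐ[ℚ] N) * h)) ∧
          (dedekindZeta₁ (IntermediateField.fixedField (Subgroup.zpowers σ)) β₁ ≠ 0 →
              |(∑ p ∈ (Nat.primesLE ⌊x + h⌋₊).filter
                  (fun p : ℕ => ¬ ((p : ℤ) ∣ NumberField.discr N) ∧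
                    ∃ (Q : Ideal (𝓞 N)) (_ : Q.IsMaximal) (_ : Q.LiesOver (span {(p : ℤ)})) (φ g : N ≃ₐ[ℚ] N),
                      IsArithFrobAt ℤ φ Q ∧ Q.inertia (N ≃ₐ[ℚ] N) = ⊥ ∧ g * φ * g⁻¹ = σ), Real.log p) -
                (∑ p ∈ (Nat.primesLE ⌊x⌋₊).filter
                  (fun p : ℕ => ¬ ((p : ℤ) ∣ NumberField.discr N) ∧
                    ∃ (Q : Ideal (𝓞 N)) (_ : Q.IsMaximal) (_ : Q.LiesOver (span {(p : ℤ)})) (φ g : N ≃ₐ[ℚ] N),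
                      IsArithFrobAt ℤ φ Q ∧ Q.inertia (N ≃ₐ[ℚ] N) = ⊥ ∧ g * φ * g⁻¹ = σ), Real.log p) -
                (Nat.card {τ : N ≃ₐ[ℚ] N // IsConj σ τ} : ℝ) / Nat.card (N ≃ₐ[ℚ] N) *
                  (h + ((x + h) ^ β₁ - x ^ β₁) / β₁)| ≤
                κ * ((Nat.card {τ : N ≃ₐ[ℚ] N // IsConj σ τ} : ℝ) / Nat.card (N ≃ₐ[ℚ] N) * h))) := by
  have hn0 : (0 : ℝ) < n := by exact_mod_cast (lt_trans Nat.zero_lt_one hn)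
  have hn1 : (1 : ℝ) ≤ n := by exact_mod_cast hn.le
  -- the `ψ`-form input at precision `κ/4`
  have hκ4 : 0 < κ / 4 := by positivity
  have hκ41 : κ / 4 ≤ 1 := by linarith
  obtain ⟨δ, a₂, c, c', hδ0, hδ64, ha₂1, hc, hcn, hc'0, hc'c, hmain⟩ := frobeniusWindowPsi_dichotomy n hn hκ4 hκ41
  -- the final window constant: also below Stark's odd-degree bound `1/(8(2n)!)`
  set c₂ : ℝ := min c' (1 / (8 * ((2 * n).factorial : ℝ))) with hc₂
  have hc₂0 : 0 < c₂ := lt_min hc'0 (by positivity)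
  have hc₂c' : c₂ ≤ c' := min_le_left _ _
  have hc₂fac : c₂ ≤ 1 / (8 * ((2 * n).factorial : ℝ)) := min_le_right _ _
  obtain ⟨L₀, hL₀0, hW⟩ := rpow_div_le_of_ge_window hc₂0 hκ4
  set e : ℝ := 1 + n * Real.log n / Real.log 3 with he
  have hlog3 : 0 < Real.log 3 := Real.log_pos (by norm_num)
  have hlogn : 0 ≤ Real.log n := Real.log_nonneg hn1
  have he0 : 0 ≤ (n : ℝ) * Real.log n / Real.log 3 := by positivity
  have he1 : 1 ≤ e := by rw [he]; linarith
  set L₃ : ℝ := max 0 (64 / 15 * Real.log (480 * n / κ)) with hL₃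
  set L : ℝ := max (max (e * a₂) 8) (max L₀ L₃) with hL
  have hLea : e * a₂ ≤ L := le_trans (le_max_left _ _) (le_max_left _ _)
  have hL8 : (8 : ℝ) ≤ L := le_trans (le_max_right _ _) (le_max_left _ _)
  have hLL₀ : L₀ ≤ L := le_trans (le_max_left _ _) (le_max_right _ _)
  have hLL₃ : L₃ ≤ L := le_trans (le_max_right _ _) (le_max_right _ _)
  have hc4' : c ≤ 1 / 4 := by
    refine hcn.trans ?_
    rw [div_le_div_iff_of_pos_left one_pos (by positivity) (by norm_num)]; nlinarith
  refine ⟨δ, L, c₂, hδ0, hδ64, by linarith, hc₂0, hc₂c'.trans (hc'c.trans hc4'), hc₂fac,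
    fun N _ _ _ hN σ x h hx hhx hhx' => ?_⟩
  -- sizes depending on `N`
  have hN1 : 1 < Module.finrank ℚ N := by rw [hN]; exact hn
  set d : ℝ := ((NumberField.discr N).natAbs : ℝ) with hd
  have hd3 : (3 : ℝ) ≤ d := three_le_natAbs_discr_real N hN1
  obtain ⟨hd0, hd1⟩ : (0 : ℝ) < d ∧ (1 : ℝ) ≤ d := ⟨by linarith, by linarith⟩
  have hlogd0 : 0 < Real.log d := Real.log_pos (by linarith)
  have hlog4 : 0 < Real.log 4 := Real.log_pos (by norm_num)
  -- the fixed field of `⟨σ⟩`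
  set H : Subgroup (N ≃ₐ[ℚ] N) := Subgroup.zpowers σ with hH
  set E : IntermediateField ℚ N := IntermediateField.fixedField H with hE
  have hfix : E.fixingSubgroup = H := IntermediateField.fixingSubgroup_fixedField H
  have hσE : σ ∈ E.fixingSubgroup := by rw [hfix]; exact Subgroup.mem_zpowers σ
  haveI : IsCyclic E.fixingSubgroup := by rw [hfix]; infer_instance
  haveI : IsCyclic (N ≃ₐ[E] N) :=
    isCyclic_of_surjective (IntermediateField.fixingSubgroupEquiv E).toMonoidHom
      (IntermediateField.fixingSubgroupEquiv E).surjective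
  have hcomm : ∀ a b : N ≃ₐ[E] N, Commute a b := fun a b => IsCyclic.commGroup.mul_comm a b
  haveI : FiniteDimensional E N := Module.Finite.of_restrictScalars_finite ℚ E N
  set τ' : N ≃ₐ[E] N := IntermediateField.fixingSubgroupEquiv E ⟨σ, hσE⟩ with hτ'
  set m : ℕ := Module.finrank E N with hm
  have hcardm : Nat.card (N ≃ₐ[E] N) = m := IsGalois.card_aut_eq_finrank E N
  have horder : orderOf τ' = m := by
    rw [hτ', MulEquiv.orderOf_eq, Subgroup.orderOf_mk, ← Nat.card_zpowers, ← hH, ← hcardm,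
      ← Nat.card_congr (IntermediateField.fixingSubgroupEquiv E).toEquiv, hfix]
  obtain ⟨χ₁, hχ₁, hA, hB, hB'⟩ := hmain E N hN
  -- the Frobenius weight of `σ`
  set w : Ideal (𝓞 E) → ℝ := fun I => if (∃ v : HeightOneSpectrum (𝓞 E),
    Algebra.IsUnramifiedIn (𝓞 N) v.asIdeal ∧ ∃ k : ℕ, I = v.asIdeal ^ k ∧ galFrob E N v ^ k = τ') then 1 else 0
    with hwdef
  have hw : ∀ I, w I = if (∃ v : HeightOneSpectrum (𝓞 E), Algebra.IsUnramifiedIn (𝓞 N) v.asIdeal ∧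
      ∃ k : ℕ, I = v.asIdeal ^ k ∧ galFrob E N v ^ k = τ') then 1 else 0 := fun I => rfl
  -- group-theoretic constants
  set ν : ℝ := (Nat.card (Subgroup.centralizer ({σ} : Set (N ≃ₐ[ℚ] N))) : ℝ) with hν
  have hνpos : 0 < ν := by rw [hν]; exact_mod_cast card_centralizer_pos σ
  set δC : ℝ := (Nat.card {τ : N ≃ₐ[ℚ] N // IsConj σ τ} : ℝ) / Nat.card (N ≃ₐ[ℚ] N) with hδC
  have hG0 : (0 : ℝ) < Nat.card (N ≃ₐ[ℚ] N) := by exact_mod_cast Nat.card_pos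
  have hδν : δC * ν = 1 := by
    rw [hδC, hν, div_mul_eq_mul_div, div_eq_one_iff_eq hG0.ne']
    exact_mod_cast card_isConj_mul_card_centralizer σ
  have hδCpos : 0 < δC := by
    by_contra h0; push Not at h0
    have : δC * ν ≤ 0 := mul_nonpos_of_nonpos_of_nonneg h0 hνpos.le
    linarith
  -- `x ≥ d^L`: the thresholds
  have hQd : ThornerZaman.condQn N ≤ d ^ e := by
    have h' := condQn_le_natAbs_discr_rpow N hN1
    rw [hN] at h'; exact h'
  have hQ0 : (0 : ℝ) ≤ ThornerZaman.condQn N := by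
    have := ThornerZaman.twelve_le_condQn (K := N) hN1; linarith
  have hmono : ∀ {a b : ℝ}, a ≤ b → d ^ a ≤ d ^ b := fun hab => Real.rpow_le_rpow_of_exponent_le hd1 hab
  have hQx : ThornerZaman.condQn N ^ a₂ ≤ x := by
    calc ThornerZaman.condQn N ^ a₂ ≤ (d ^ e) ^ a₂ := Real.rpow_le_rpow hQ0 hQd (by linarith)
      _ = d ^ (e * a₂) := by rw [Real.rpow_mul hd0.le]
      _ ≤ d ^ L := hmono hLea
      _ ≤ x := hx
  have hL₀x : d ^ L₀ ≤ x := (hmono hLL₀).trans hx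
  have hd8x : d ^ (8 : ℝ) ≤ x := (hmono hL8).trans hx
  have hx3 : (3 : ℝ) ≤ x := by
    have : d ≤ d ^ (8 : ℝ) := by
      have := Real.rpow_le_rpow_of_exponent_le hd1 (show (1:ℝ) ≤ 8 by norm_num); rwa [Real.rpow_one] at this
    linarith
  have hx1 : 1 < x := by linarith
  have hx0 : 0 < x := by linarith
  have hxδ : 0 < x ^ (1 - δ) := Real.rpow_pos_of_pos hx0 _
  have hh0 : 0 < h := lt_of_lt_of_le hxδ hhx
  have hd8 : d ≤ x ^ (1 / 8 : ℝ) := by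
    have := Real.rpow_le_rpow (Real.rpow_nonneg hd0.le _) hd8x (by norm_num : (0 : ℝ) ≤ 1 / 8)
    rwa [← Real.rpow_mul hd0.le, show (8 : ℝ) * (1 / 8) = 1 by norm_num, Real.rpow_one] at this
  have hd8' : d ≤ (x + h) ^ (1 / 8 : ℝ) :=
    hd8.trans (Real.rpow_le_rpow hx0.le (by linarith) (by norm_num))
  -- the comparison `|m Δψ_σ − ν ΔS| ≤ 120 n x^{3/4} ≤ (κ/4) h`
  have hcomp :
      |(m : ℝ) * ((∑ k ∈ Icc 0 ⌊x + h⌋₊, ∑ I ∈ idealsOfNorm E k, w I * idealVonMangoldt I) -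
          (∑ k ∈ Icc 0 ⌊x⌋₊, ∑ I ∈ idealsOfNorm E k, w I * idealVonMangoldt I)) -
        ν * ((∑ p ∈ (Nat.primesLE ⌊x + h⌋₊).filter
          (fun p : ℕ => ¬ ((p : ℤ) ∣ NumberField.discr N) ∧
            ∃ (Q : Ideal (𝓞 N)) (_ : Q.IsMaximal) (_ : Q.LiesOver (span {(p : ℤ)})) (φ g : N ≃ₐ[ℚ] N),
              IsArithFrobAt ℤ φ Q ∧ Q.inertia (N ≃ₐ[ℚ] N) = ⊥ ∧ g * φ * g⁻¹ = σ), Real.log p) -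
          (∑ p ∈ (Nat.primesLE ⌊x⌋₊).filter
          (fun p : ℕ => ¬ ((p : ℤ) ∣ NumberField.discr N) ∧
            ∃ (Q : Ideal (𝓞 N)) (_ : Q.IsMaximal) (_ : Q.LiesOver (span {(p : ℤ)})) (φ g : N ≃ₐ[ℚ] N),
              IsArithFrobAt ℤ φ Q ∧ Q.inertia (N ≃ₐ[ℚ] N) = ⊥ ∧ g * φ * g⁻¹ = σ), Real.log p))| ≤
        κ / 4 * h := by
    have h1 := abs_card_mul_psiFrob_sub_le (N := N) E hcomm hσE hw hx1.le
    have h2 := abs_card_mul_psiFrob_sub_le (N := N) E hcomm hσE hw (by linarith : (1 : ℝ) ≤ x + h)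
    rw [hcardm] at h1 h2
    have hj1 := classJunk_le (N := N) E hx1 hd8
    have hj2 := classJunk_le (N := N) E (by linarith : (1 : ℝ) < x + h) hd8'
    rw [hcardm, hN] at hj1 hj2
    have h34 := rpow_threeQuarters_add_le hx0 hh0.le hhx'
    have hL₃' : 64 / 15 * Real.log (480 * n / κ) ≤ L := le_trans (le_max_right _ _) hLL₃
    have hjunk := junk_le_quarter_mul (δ := δ) hn0 hκ hd3 hL₃' (by linarith) hx hδ64 hhx
    have e1 := h1.trans hj1
    have e2 := h2.trans hj2
    rw [abs_le] at e1 e2 ⊢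
    constructor <;> nlinarith [e1.1, e1.2, e2.1, e2.2, h34, hjunk, Real.rpow_nonneg hx0.le (3 / 4 : ℝ)]
  -- `1/2 ≤ β₁` in the `c`-window
  have hβhalf_of : ∀ {cc β₁ : ℝ}, cc ≤ c → 1 - cc / (Real.log d + Real.log 4) < β₁ → 1 / 2 ≤ β₁ := by
    intro cc β₁ hcc hwin
    have hlog4' : 1 < Real.log 4 := by
      rw [show (4:ℝ) = 2 ^ 2 by norm_num, Real.log_pow]; have := Real.log_two_gt_d9; push_cast; linarith
    have : cc / (Real.log d + Real.log 4) ≤ 1 / 4 := by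
      rw [div_le_iff₀ (by linarith)]; nlinarith
    linarith
  refine ⟨fun hexc => ?_, fun β₁ hζ hwin hβ1 => ⟨fun hζE => ?_, fun hζE => ?_⟩⟩
  · -- (A): no zero in the `c'`-window; `|m Δψ − h| ≤ (κ/2) h` whether or not a zero hides in the `c`-window
    have h1 : |(m : ℝ) * ((∑ k ∈ Icc 0 ⌊x + h⌋₊, ∑ I ∈ idealsOfNorm E k, w I * idealVonMangoldt I) -
          (∑ k ∈ Icc 0 ⌊x⌋₊, ∑ I ∈ idealsOfNorm E k, w I * idealVonMangoldt I)) - h| ≤ κ / 2 * h := by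
      by_cases hz : ∃ β₁ : ℝ, dedekindZeta₁ N β₁ = 0 ∧
          1 - c / (Real.log ((NumberField.discr N).natAbs : ℝ) + Real.log 4) < β₁ ∧ β₁ < 1
      · obtain ⟨β₁, hζ, hwin, hβ1⟩ := hz
        have hβc' : β₁ ≤ 1 - c₂ / (Real.log d + Real.log 4) := by
          by_contra hlt
          exact hexc ⟨β₁, hζ, lt_of_not_ge hlt, hβ1⟩
        have hβhalf := hβhalf_of le_rfl hwin
        have hβ0 : 0 < β₁ := by linarith
        have hbd := hB β₁ hζ hwin hβ1 τ' w hw x h hQx hhx hhx'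
        rw [← hm] at hbd
        -- the secondary term: `I ≤ h x^{β₁−1} ≤ (κ/4) h`
        have hy : x ^ β₁ / β₁ ≤ κ / 4 * x := hW d hd3 x hL₀x β₁ hβhalf hβc'
        have hxβ : x ^ (β₁ - 1) ≤ κ / 4 := by
          have h2 : x ^ β₁ ≤ β₁ * (κ / 4 * x) := by rwa [div_le_iff₀' hβ0] at hy
          have h3 : β₁ * (κ / 4 * x) ≤ 1 * (κ / 4 * x) := mul_le_mul_of_nonneg_right hβ1.le (by positivity)
          rw [Real.rpow_sub_one hx0.ne', div_le_iff₀ hx0]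
          linarith
        have hI : ((x + h) ^ β₁ - x ^ β₁) / β₁ ≤ κ / 4 * h := by
          refine (rpow_window_div_le hx0 hh0.le hβ0 hβ1.le).trans ?_
          have := mul_le_mul_of_nonneg_left hxβ hh0.le
          linarith
        have := abs_le.1 hbd
        rw [abs_le]; constructor <;> linarith [this.1, this.2]
      · have hbd := hA τ' w hw x h hQx hhx hhx' hz
        rw [← hm] at hbd
        refine hbd.trans ?_
        nlinarith
    have key := window_transfer hνpos hδν h1 hcomp
    refine key.trans ?_
    have hp : 0 ≤ κ * (δC * h) := by positivity
    linarith [hp]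
  · -- (B), `ζ_E(β₁) = 0`: the sign is `+1`
    have hwin' : 1 - c' / (Real.log d + Real.log 4) < β₁ := by
      have := div_le_div_of_nonneg_right hc₂c' (by linarith : 0 ≤ Real.log d + Real.log 4); linarith
    have hβhalf : 1 / 2 ≤ β₁ := hβhalf_of hc'c hwin'
    have hβ0 : 0 < β₁ := by linarith
    obtain ⟨j₀, hj₀m, hiff, hsq, hBf⟩ := hB' β₁ hζ hwin' hβ1
    have hj0 : j₀ = 0 := hiff.mpr hζE
    have hbd := hBf τ' w hw x h hQx hhx hhx'
    rw [← hm] at hbd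
    rw [hj0, pow_zero, Complex.one_re, one_mul] at hbd
    have key := window_transfer hνpos hδν hbd hcomp
    refine key.trans ?_
    have hp : 0 ≤ κ * (δC * h) := by positivity
    linarith [hp]
  · -- (B), `ζ_E(β₁) ≠ 0`: the sign is `−1`
    have hwin' : 1 - c' / (Real.log d + Real.log 4) < β₁ := by
      have := div_le_div_of_nonneg_right hc₂c' (by linarith : 0 ≤ Real.log d + Real.log 4); linarith
    have hβhalf : 1 / 2 ≤ β₁ := hβhalf_of hc'c hwin'
    have hβ0 : 0 < β₁ := by linarith
    obtain ⟨j₀, hj₀m, hiff, hsq, hBf⟩ := hB' β₁ hζ hwin' hβ1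
    have hj0 : j₀ ≠ 0 := fun h0 => hζE (hiff.mp h0)
    have hneg : ((χ₁ τ' : ℂˣ) : ℂ) ^ j₀ = -1 :=
      character_pow_eq_neg_one χ₁ hχ₁ τ' horder (Nat.pos_of_ne_zero hj0) hj₀m (hsq τ')
    have hre : ((((χ₁ τ' : ℂˣ) : ℂ)⁻¹) ^ j₀).re = -1 := by
      rw [inv_pow, hneg, inv_neg, inv_one, Complex.neg_re, Complex.one_re]
    have hbd := hBf τ' w hw x h hQx hhx hhx'
    rw [← hm] at hbd
    rw [hre] at hbd
    have e1 : h - (-1) * (((x + h) ^ β₁ - x ^ β₁) / β₁) = h + ((x + h) ^ β₁ - x ^ β₁) / β₁ := by ring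
    rw [e1] at hbd
    have key := window_transfer hνpos hδν hbd hcomp
    refine key.trans ?_
    have hp : 0 ≤ κ * (δC * h) := by positivity
    linarith [hp]

end Summit.QuantumAdvantage.QuantumAdvantage.Theorems.DegreeOnePrimesEscape

end
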